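import Summits.QuantumFields.YangMills.Theorems.UnitScaleTiltProp7QTwSCentralAdditiveRegPr
import HarnessLib

/-!
# Route `UnitScaleTilt`, crux K1 child «MinimiserStabilityRegPr» (stmt-QuantumFields-19200), stub `stub_existenceMinimalOrbit` (EX), the J-term rows of the EX knit —
# **(Q-b)⁽²⁾ UNCONDITIONAL: THE DISPLAYED TOWER ROW `htower` OF ✓`…QTwSCentralAdditiveRegPr` SUPPLIED AT `U₀ ∈ 𝔘_k(ε₀)`** — at every level `j < K − n` and every `A` in the ball
# `‖A‖ < η∕(10⁹L²)`, the (0.4) loop variables of the perturbed covariant tower `dbarCovIterU j U₀♭ (e^{A}U₀♭)` and its twisted stair transporters against the background tower `Ū₀♭ʲ` are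
# within `1∕8` of `1`: the perturbed tower is bondwise within `3(2e + 2700Lε₀)` of the `SU(2)`-valued background tower RELATIVELY (★w4-20520 g3's ✓`norm_dbarCovIterU_rel_frameAccU_le_of_plaqSmall`,
# W2's budgets ✓`budget_T3_frames`, level by level), the background tower IS the route's `SU(2)` tower (✓`coe_iter_eq_emlIterU_of_regPr`), and holonomies along words of `≤ ℓ` letters of two
# fields that are bondwise `δ`-close with one of them `U1`-valued differ by `≤ 2ℓδ` (§1); whence p01 g2's `hAvgC` with NO displayed row.

Cell `ym3-torus`, width seat `ym-ust-20520-w5` (gen 5).  `--supports stmt-QuantumFields-19200 --as helper`; THEOREMS ONLY (0 `def`, 0 `sorry`); count-neutral; nothing here claims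
the stub, the crux, d = 4 or the mass gap — YM₃ on T³ is a ladder rung (R3), not the Clay problem.

WHAT IS PROVED.
* §1 (generic normed ring `𝔸`, `‖1‖ = 1`) `holT_mem_U1`; ★`norm_holT_sub_holT_le` — `‖hol_W(Γ) − hol_V(Γ)‖ ≤ 2|Γ|δ` for `V` `U1`-valued, `‖W(b) − V(b)‖, ‖W(b)⁻¹ − V(b)⁻¹‖ ≤ δ`, `2|Γ|δ ≤ 1`;
  `norm_sub_le_of_rel`, `norm_inv_sub_inv_le_of_rel` (`‖wu⁻¹ − 1‖ ≤ r ≤ ½`, `u ∈ U1` ⟹ `‖w − u‖ ≤ r`, `‖w⁻¹ − u⁻¹‖ ≤ 2r`); `norm_loopHolU_sub_one_le_of_rel`, `norm_tstairU_sub_one_le_of_rel`.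
* §2 (T³ at `U₀ ∈ 𝔘_k(ε₀)`) `emlIterU_bgUnits_mem_U1_of_regPr`; `loop_budget_sixteenth` + `loopHolU_emlIterU_bgUnits_le_sixteenth_of_regPr` (the `1∕16` form of ✓`…_le_eighth_of_regPr`);
  ★★`norm_dbarCovIterU_rel_sub_one_le_of_regPr` — LEVEL-WISE relative smallness `‖U̿^{(j)}[e^{A}U₀♭](e)·Ū^{(j)}[U₀♭](e)⁻¹ − 1‖ ≤ 3(2e + 2700Lε₀)` for `‖A(b)‖ ≤ e·η`, every `j ≤ K − n`
  (W3 part 1 at `k := j`, budgets by monotonicity from W2's level-`(K−n)` ✓`budget_T3_frames`∕✓`windows_of_numerals`).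
* §3 ★★★`towerRows_of_regPr` — the row `htower` of ✓`fderiv_fderiv_logChartTwS_central_eq_zero_of_regPr` at radius `η∕(10⁹L²)`; ★★★`fderiv_fderiv_logChartTwS_central_eq_zero_at_regPr (hε₀)
  (hWε : 10¹²L³ε₀ ≤ 1) (U₀) (hreg) : ∀ X z, fderiv ℂ (fun A => fderiv ℂ (logChartTwS F n K h U₀) A) 0 X (z·1) = 0` — p01 g2's `hAvgC` VERBATIM, NO displayed row; and the other slot.
HONEST SCOPE.  Compositions of landed theorems with explicit numerals; nothing of [Balaban1985Averaging]∕[Balaban1985BackgroundPropagators] asserted.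
References: [Balaban1985Averaging] CMP 98 ((11)–(12), (58), (89)–(92), (161)–(163)); [Balaban1985BackgroundPropagators] CMP 99 ((3.14), (3.127)); [Balaban1985Variational] CMP 102 ((2), (146)); [Balaban1987RG1] CMP 109 ((0.3)–(0.4)).
-/

set_option autoImplicit false

noncomputable section

open scoped Matrix.Norms.L2Operator
open Filter Topology Metric

namespace Summit.QuantumFields.YangMills.Theorems.Prop7SymAvgTwSym

open NormedSpace
open Literature.MathematicalPhysics.QuantumFieldTheory.Balaban1983to89
open T4Continuum BlockAveraging AveragingRT ExpMeanLog MatrixLog BlockAveragingEMLLinearised LatticeFieldCalculus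
open LatticeWordStokes (length_loopWord_le dist1_loopHol_le)
open FederbushMean (dist1_SU_eq)
open B10Eq27TorusAxialLog (holT holT_nil holT_cons_true holT_cons_false unitsField toUField)
open B7Prop1Explicit (expUnit U1 mem_U1)
open B7Prop2SpecialUnitary (specialUnitaryUnits mem_specialUnitaryUnits specialUnitaryUnits_le_U1)
open B7Prop6Flat (norm_units_inv_sub_one_le)
open T3ContinuumYM3Torus
open T3LevelShift (bondShift)
open T3PrintedRegularOrbits (sites_eq)
open T3RegularMinimiser (regThreshold)
open T3PrintedRegularMinimiser (RegPr)
open T3SectALandauChart (eta eta_pos bgUnits)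
open Summit.QuantumFields.YangMills.Theorems.Prop8Chart (loopHolU emlIterU expCfg coe_loopHolU_unitsField)
open Summit.QuantumFields.YangMills.Theorems.Prop7SymAvgGLSmallOfRegPr (coe_iter_eq_emlIterU_of_regPr bgUnits_eq)
open Summit.QuantumFields.YangMills.Theorems.IterPlaqSmallAllL (plaqSmall_iter_T3_allL)
open Summit.QuantumFields.YangMills.Theorems.Prop7SymAvgRelativeBound (perturbedField_eq budget_T3)
open Summit.QuantumFields.YangMills.Theorems.Prop7DbarTwWindow (norm_smul_eta_inv_le)
open Summit.QuantumFields.YangMills.Theorems.Prop7DbarTwSymWindow (budget_T3_frames windows_of_numerals hstep_T3 hframe_T3)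
open Summit.QuantumFields.YangMills.Theorems.Prop7SymFrameRelCluster (norm_dbarCovIterU_rel_frameAccU_le_of_plaqSmall)
open Summit.QuantumFields.YangMills.Theorems.Prop7CmapTwInputs (norm_apply_le_of_mem_ball)

/-! ## §1 Relative holonomy against a `U1`-valued field -/

section Rel

variable {𝔸 : Type*} [NormedRing 𝔸] [NormOneClass 𝔸]
variable {P : Params} {j : ℕ}

/-- transports of a `U1`-valued field are `U1`-valued (`U1` is a subgroup). [folklore] -/
theorem holT_mem_U1 {V : GaugeField P j 𝔸ˣ} (hV : ∀ b, V b ∈ U1 𝔸) : ∀ (x : Site P j) (w : List (Letter P.d)), holT V x w ∈ U1 𝔸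
  | x, [] => by rw [holT_nil]; exact (U1 𝔸).one_mem
  | x, (μ, true) :: w => by rw [holT_cons_true]; exact (U1 𝔸).mul_mem (hV _) (holT_mem_U1 hV _ _)
  | x, (μ, false) :: w => by rw [holT_cons_false]; exact (U1 𝔸).mul_mem ((U1 𝔸).inv_mem (hV _)) (holT_mem_U1 hV _ _)

omit [NormOneClass 𝔸] in
/-- one telescoping step: `‖gh − uk‖ ≤ 2δ + E` for `‖g − u‖ ≤ δ`, `‖u‖, ‖k‖ ≤ 1`, `‖h − k‖ ≤ E ≤ 1`. [folklore] -/
theorem norm_mul_sub_mul_le_step {g u h k : 𝔸} {δ E : ℝ} (hδ : 0 ≤ δ) (hgu : ‖g - u‖ ≤ δ) (hu : ‖u‖ ≤ 1) (hk : ‖k‖ ≤ 1)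
    (hhk : ‖h - k‖ ≤ E) (hE : E ≤ 1) : ‖g * h - u * k‖ ≤ 2 * δ + E := by
  have hh : ‖h‖ ≤ 2 := by
    have h1 : ‖h‖ ≤ ‖k‖ + ‖h - k‖ := by
      calc ‖h‖ = ‖k + (h - k)‖ := by congr 1; abel
        _ ≤ ‖k‖ + ‖h - k‖ := norm_add_le _ _
    linarith
  have hid : g * h - u * k = (g - u) * h + u * (h - k) := by noncomm_ring
  rw [hid]
  have hE0 : 0 ≤ E := (norm_nonneg _).trans hhk
  calc ‖(g - u) * h + u * (h - k)‖ ≤ ‖g - u‖ * ‖h‖ + ‖u‖ * ‖h - k‖ := (norm_add_le _ _).trans (add_le_add (norm_mul_le _ _) (norm_mul_le _ _))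
    _ ≤ δ * 2 + 1 * E :=
        add_le_add (mul_le_mul hgu hh (norm_nonneg _) hδ) (mul_le_mul hu hhk (norm_nonneg _) zero_le_one)
    _ = 2 * δ + E := by ring

/-- ★ **HOLONOMIES OF TWO BONDWISE-CLOSE FIELDS, ONE OF THEM `U1`-VALUED**: `‖W(Γ) − V(Γ)‖ ≤ 2|Γ|δ` when `‖W(b) − V(b)‖ ≤ δ`, `‖W(b)⁻¹ − V(b)⁻¹‖ ≤ δ`, `V(b) ∈ U1`, `2|Γ|δ ≤ 1`
(telescoping: `gh − uk = (g − u)h + u(h − k)`, `‖h‖ ≤ 1 + ‖h − k‖ ≤ 2`). [cite: Balaban1985Averaging, (11)-(12) p.19, (161) p.42] -/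
theorem norm_holT_sub_holT_le (W V : GaugeField P j 𝔸ˣ) {δ : ℝ} (hδ : 0 ≤ δ) (hV : ∀ b, V b ∈ U1 𝔸)
    (h₁ : ∀ b, ‖((W b : 𝔸ˣ) : 𝔸) - ((V b : 𝔸ˣ) : 𝔸)‖ ≤ δ) (h₂ : ∀ b, ‖(((W b)⁻¹ : 𝔸ˣ) : 𝔸) - (((V b)⁻¹ : 𝔸ˣ) : 𝔸)‖ ≤ δ) :
    ∀ (x : Site P j) (w : List (Letter P.d)), 2 * (w.length : ℝ) * δ ≤ 1 →
      ‖((holT W x w : 𝔸ˣ) : 𝔸) - ((holT V x w : 𝔸ˣ) : 𝔸)‖ ≤ 2 * (w.length : ℝ) * δ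
  | x, [], _ => by rw [holT_nil, holT_nil, sub_self, norm_zero, List.length_nil, Nat.cast_zero, mul_zero, zero_mul]
  | x, (μ, true) :: w, hlen => by
    rw [List.length_cons, Nat.cast_succ] at hlen ⊢
    have hlen' : 2 * (w.length : ℝ) * δ ≤ 1 := by nlinarith
    have ih := norm_holT_sub_holT_le W V hδ hV h₁ h₂ (x.shift μ) w hlen'
    rw [holT_cons_true, holT_cons_true, Units.val_mul, Units.val_mul]
    have := norm_mul_sub_mul_le_step hδ (h₁ ⟨x, μ⟩) (mem_U1.1 (hV ⟨x, μ⟩)).1 (mem_U1.1 (holT_mem_U1 hV (x.shift μ) w)).1 ih hlen'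
    linarith
  | x, (μ, false) :: w, hlen => by
    rw [List.length_cons, Nat.cast_succ] at hlen ⊢
    have hlen' : 2 * (w.length : ℝ) * δ ≤ 1 := by nlinarith
    have ih := norm_holT_sub_holT_le W V hδ hV h₁ h₂ (x.unshift μ) w hlen'
    rw [holT_cons_false, holT_cons_false, Units.val_mul, Units.val_mul]
    have := norm_mul_sub_mul_le_step hδ (h₂ ⟨x.unshift μ, μ⟩) (mem_U1.1 (hV ⟨x.unshift μ, μ⟩)).2 (mem_U1.1 (holT_mem_U1 hV (x.unshift μ) w)).1 ih hlen'
    linarith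

/-- `‖wu⁻¹ − 1‖ ≤ r`, `u ∈ U1` ⟹ `‖w − u‖ ≤ r`. [folklore] -/
theorem norm_sub_le_of_rel {w u : 𝔸ˣ} {r : ℝ} (hu : u ∈ U1 𝔸) (h : ‖(w : 𝔸) * ((u⁻¹ : 𝔸ˣ) : 𝔸) - 1‖ ≤ r) :
    ‖(w : 𝔸) - (u : 𝔸)‖ ≤ r := by
  have hid : (w : 𝔸) - (u : 𝔸) = ((w : 𝔸) * ((u⁻¹ : 𝔸ˣ) : 𝔸) - 1) * (u : 𝔸) := by
    rw [sub_mul, one_mul, mul_assoc, Units.inv_mul, mul_one]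
  rw [hid]
  have hr : 0 ≤ r := (norm_nonneg _).trans h
  calc ‖((w : 𝔸) * ((u⁻¹ : 𝔸ˣ) : 𝔸) - 1) * (u : 𝔸)‖ ≤ ‖(w : 𝔸) * ((u⁻¹ : 𝔸ˣ) : 𝔸) - 1‖ * ‖(u : 𝔸)‖ := norm_mul_le _ _
    _ ≤ r * 1 := mul_le_mul h (mem_U1.1 hu).1 (norm_nonneg _) hr
    _ = r := mul_one r

/-- `‖wu⁻¹ − 1‖ ≤ r ≤ ½`, `u ∈ U1` ⟹ `‖w⁻¹ − u⁻¹‖ ≤ 2r` (`w⁻¹ = u⁻¹(wu⁻¹)⁻¹`, ✓`norm_units_inv_sub_one_le`). [folklore] -/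
theorem norm_inv_sub_inv_le_of_rel {w u : 𝔸ˣ} {r : ℝ} (hu : u ∈ U1 𝔸) (hr : r ≤ 1 / 2) (h : ‖(w : 𝔸) * ((u⁻¹ : 𝔸ˣ) : 𝔸) - 1‖ ≤ r) :
    ‖((w⁻¹ : 𝔸ˣ) : 𝔸) - ((u⁻¹ : 𝔸ˣ) : 𝔸)‖ ≤ 2 * r := by
  set R : 𝔸ˣ := w * u⁻¹ with hR
  have hRv : ‖(R : 𝔸) - 1‖ ≤ r := by rw [hR, Units.val_mul]; exact h
  have hRi : ‖((R⁻¹ : 𝔸ˣ) : 𝔸) - 1‖ ≤ 2 * ‖(R : 𝔸) - 1‖ := norm_units_inv_sub_one_le R (hRv.trans hr)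
  have hw : ((w⁻¹ : 𝔸ˣ) : 𝔸) - ((u⁻¹ : 𝔸ˣ) : 𝔸) = ((u⁻¹ : 𝔸ˣ) : 𝔸) * (((R⁻¹ : 𝔸ˣ) : 𝔸) - 1) := by
    rw [mul_sub, mul_one, ← Units.val_mul, hR, mul_inv_rev, inv_inv, inv_mul_cancel_left]
  rw [hw]
  have hr0 : 0 ≤ r := (norm_nonneg _).trans h
  calc ‖((u⁻¹ : 𝔸ˣ) : 𝔸) * (((R⁻¹ : 𝔸ˣ) : 𝔸) - 1)‖ ≤ ‖((u⁻¹ : 𝔸ˣ) : 𝔸)‖ * ‖((R⁻¹ : 𝔸ˣ) : 𝔸) - 1‖ := norm_mul_le _ _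
    _ ≤ 1 * (2 * r) := mul_le_mul (mem_U1.1 hu).2 (hRi.trans (by linarith)) (norm_nonneg _) zero_le_one
    _ = 2 * r := one_mul _

/-- **THE (0.4) LOOP VARIABLES OF `W` AGAINST THOSE OF A `U1`-VALUED `V`**: `‖W(loop) − 1‖ ≤ 2ℓδ + ‖V(loop) − 1‖` (`ℓ = (d+2)L` bounds the loop words, `2ℓδ ≤ 1`).
[cite: Balaban1987RG1, (0.4) p.253; Balaban1985Averaging, (161) p.42] -/
theorem norm_loopHolU_sub_one_le_of_rel (W V : GaugeField P j 𝔸ˣ) {δ : ℝ} (hδ : 0 ≤ δ) (hV : ∀ b, V b ∈ U1 𝔸)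
    (h₁ : ∀ b, ‖((W b : 𝔸ˣ) : 𝔸) - ((V b : 𝔸ˣ) : 𝔸)‖ ≤ δ) (h₂ : ∀ b, ‖(((W b)⁻¹ : 𝔸ˣ) : 𝔸) - (((V b)⁻¹ : 𝔸ˣ) : 𝔸)‖ ≤ δ)
    (hℓ : 2 * ((((P.d + 2) * P.L : ℕ) : ℝ)) * δ ≤ 1) (c : PBond P (j + 1)) (i : Idx P) :
    ‖((loopHolU W c i : 𝔸ˣ) : 𝔸) - 1‖ ≤ 2 * ((((P.d + 2) * P.L : ℕ) : ℝ)) * δ + ‖((loopHolU V c i : 𝔸ˣ) : 𝔸) - 1‖ := by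
  have hlen : ((loopWord P.L c.dir (off i.1) i.2.1 i.2.2).length : ℝ) ≤ (((P.d + 2) * P.L : ℕ) : ℝ) := by exact_mod_cast length_loopWord_le c i
  have hlen1 : 2 * ((loopWord P.L c.dir (off i.1) i.2.1 i.2.2).length : ℝ) * δ ≤ 1 := by nlinarith
  have hd := norm_holT_sub_holT_le W V hδ hV h₁ h₂ (emb c.src) (loopWord P.L c.dir (off i.1) i.2.1 i.2.2) hlen1
  unfold loopHolU
  calc ‖((holT W (emb c.src) (loopWord P.L c.dir (off i.1) i.2.1 i.2.2) : 𝔸ˣ) : 𝔸) - 1‖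
      = ‖(((holT W (emb c.src) (loopWord P.L c.dir (off i.1) i.2.1 i.2.2) : 𝔸ˣ) : 𝔸) - ((holT V (emb c.src) (loopWord P.L c.dir (off i.1) i.2.1 i.2.2) : 𝔸ˣ) : 𝔸)) +
          (((holT V (emb c.src) (loopWord P.L c.dir (off i.1) i.2.1 i.2.2) : 𝔸ˣ) : 𝔸) - 1)‖ := by congr 1; abel
    _ ≤ _ := norm_add_le _ _
    _ ≤ 2 * ((((P.d + 2) * P.L : ℕ) : ℝ)) * δ + ‖((holT V (emb c.src) (loopWord P.L c.dir (off i.1) i.2.1 i.2.2) : 𝔸ˣ) : 𝔸) - 1‖ := by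
        have : 2 * ((loopWord P.L c.dir (off i.1) i.2.1 i.2.2).length : ℝ) * δ ≤ 2 * ((((P.d + 2) * P.L : ℕ) : ℝ)) * δ := by nlinarith
        linarith

/-- **THE TWISTED STAIR TRANSPORTERS OF `W` AGAINST A `U1`-VALUED `V`**: `‖W(Γ)V(Γ)⁻¹ − 1‖ ≤ 2ℓδ`. [cite: Balaban1985Averaging, (58) p.27, (161)-(163) p.42] -/
theorem norm_tstairU_sub_one_le_of_rel (W V : GaugeField P j 𝔸ˣ) {δ : ℝ} (hδ : 0 ≤ δ) (hV : ∀ b, V b ∈ U1 𝔸)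
    (h₁ : ∀ b, ‖((W b : 𝔸ˣ) : 𝔸) - ((V b : 𝔸ˣ) : 𝔸)‖ ≤ δ) (h₂ : ∀ b, ‖(((W b)⁻¹ : 𝔸ˣ) : 𝔸) - (((V b)⁻¹ : 𝔸ˣ) : 𝔸)‖ ≤ δ)
    (hℓ : 2 * ((((P.d + 2) * P.L : ℕ) : ℝ)) * δ ≤ 1) (y : Site P (j + 1)) (i : Idx P) :
    ‖((tstairU V W y i : 𝔸ˣ) : 𝔸) - 1‖ ≤ 2 * ((((P.d + 2) * P.L : ℕ) : ℝ)) * δ := by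
  have hlen : ((stairWord i.2.1 (off i.1)).length : ℝ) ≤ (((P.d + 2) * P.L : ℕ) : ℝ) := by
    have h1 := length_walk_stairWord_le (emb y) i.2.1 i.1
    rw [length_walk] at h1
    exact_mod_cast h1
  have hlen1 : 2 * ((stairWord i.2.1 (off i.1)).length : ℝ) * δ ≤ 1 := by nlinarith
  have hd := norm_holT_sub_holT_le W V hδ hV h₁ h₂ (emb y) (stairWord i.2.1 (off i.1)) hlen1
  set a : 𝔸ˣ := holT W (emb y) (stairWord i.2.1 (off i.1)) with ha
  set u : 𝔸ˣ := holT V (emb y) (stairWord i.2.1 (off i.1)) with hu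
  have hu1 : u ∈ U1 𝔸 := holT_mem_U1 hV _ _
  rw [tstairU_def, Units.val_mul]
  have hid : (a : 𝔸) * ((u⁻¹ : 𝔸ˣ) : 𝔸) - 1 = ((a : 𝔸) - (u : 𝔸)) * ((u⁻¹ : 𝔸ˣ) : 𝔸) := by rw [sub_mul, Units.mul_inv]
  rw [hid]
  calc ‖((a : 𝔸) - (u : 𝔸)) * ((u⁻¹ : 𝔸ˣ) : 𝔸)‖ ≤ ‖(a : 𝔸) - (u : 𝔸)‖ * ‖((u⁻¹ : 𝔸ˣ) : 𝔸)‖ := norm_mul_le _ _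
    _ ≤ (2 * ((stairWord i.2.1 (off i.1)).length : ℝ) * δ) * 1 := mul_le_mul hd (mem_U1.1 hu1).2 (norm_nonneg _) (by positivity)
    _ ≤ 2 * ((((P.d + 2) * P.L : ℕ) : ℝ)) * δ := by nlinarith

end Rel

/-! ## §2 T³ at `U₀ ∈ 𝔘_k(ε₀)`: the background tower is `U1`-valued with `1∕16`-small loops; the perturbed tower is relatively `3(2e + 2700Lε₀)`-close, level by level -/

section T3

variable (F : T3Family) {n K : ℕ} (h : n ≤ K)

/-- an `SU(2)` configuration read in `(M₂)ˣ` is `U1`-valued (every level). [cite: Balaban1985Averaging, (19) p.21] -/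
theorem unitsField_toUField_mem_U1' {P : Params} {j : ℕ} (V : GaugeField P j (Matrix.specialUnitaryGroup (Fin 2) ℂ)) (b : PBond P j) :
    unitsField (toUField V) b ∈ U1 (Matrix (Fin 2) (Fin 2) ℂ) :=
  specialUnitaryUnits_le_U1 (by rw [mem_specialUnitaryUnits]; exact (V b).2)

/-- **THE BACKGROUND TOWER IS `U1`-VALUED ON `𝔘_k(ε₀)`**: `Ū₀♭ʲ = (Ū₀ʲ)♭` is the route's `SU(2)` tower read in `(M₂)ˣ` (✓`coe_iter_eq_emlIterU_of_regPr`), `j ≤ K − n`, `10⁷L³ε₀ ≤ 1`.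
[cite: Balaban1987RG1, (0.11) p.253; Balaban1985Variational, (2) p.278] -/
theorem emlIterU_bgUnits_mem_U1_of_regPr {ε₀ : ℝ} (hε₀ : 0 < ε₀) (hε : 10 ^ 7 * (F.L : ℝ) ^ 3 * ε₀ ≤ 1)
    {U₀ : GaugeField (F.P K) 0 (Matrix.specialUnitaryGroup (Fin 2) ℂ)} (hreg : RegPr F n K ε₀ U₀) {j : ℕ} (hj : j ≤ K - n) (b : PBond (F.P K) j) :
    emlIterU j (bgUnits F K U₀) b ∈ U1 (Matrix (Fin 2) (Fin 2) ℂ) := by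
  rw [bgUnits_eq, ← coe_iter_eq_emlIterU_of_regPr F n K hε₀ hε hreg hj]
  exact unitsField_toUField_mem_U1' _ b

/-- the loop budget in the `1∕16` form: `(((d+2)L)²∕4)·((10800L+1)·(L^{2j}·ε₀L^{−2(K−n)})) ≤ 1∕16` for `j ≤ K − n`, `10⁷L³ε₀ ≤ 1`. [cite: Balaban1985Variational, (146) p.301] -/
theorem loop_budget_sixteenth (n K : ℕ) {ε₀ : ℝ} (hε₀ : 0 < ε₀) (hε : 10 ^ 7 * (F.L : ℝ) ^ 3 * ε₀ ≤ 1) {s : ℕ} (hs : s ≤ K - n) :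
    ((((F.P K).d + 2) * (F.P K).L : ℕ) : ℝ) ^ 2 / 4 * ((10800 * (F.L : ℝ) + 1) * ((F.L : ℝ) ^ (2 * s) * regThreshold F n K ε₀)) ≤ 1 / 16 := by
  have hd : (F.P K).d = 3 := T3Family.P_d F K
  have hLL : ((F.P K).L : ℝ) = F.L := rfl
  have hL3 : 3 ≤ F.L := by obtain ⟨a, ha⟩ := F.hL.1; have := F.hL.2; omega
  have hL3r : (3 : ℝ) ≤ F.L := by exact_mod_cast hL3
  have hL0 : (0 : ℝ) < F.L := by linarith
  set X : ℝ := (F.L : ℝ) ^ (2 * s) * regThreshold F n K ε₀ with hX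
  have hX0 : 0 ≤ X := by rw [hX]; unfold regThreshold; positivity
  have hXε : X ≤ ε₀ := by
    rw [hX]
    unfold regThreshold
    have hle : (F.L : ℝ) ^ (2 * s) ≤ (F.L : ℝ) ^ (2 * (K - n)) := pow_le_pow_right₀ (by linarith) (by omega)
    have hpos : (0 : ℝ) < (F.L : ℝ) ^ (2 * (K - n)) := by positivity
    rw [inv_pow, show (F.L : ℝ) ^ (2 * s) * (ε₀ * ((F.L : ℝ) ^ (2 * (K - n)))⁻¹) = ε₀ * ((F.L : ℝ) ^ (2 * s) / (F.L : ℝ) ^ (2 * (K - n))) by ring]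
    calc ε₀ * ((F.L : ℝ) ^ (2 * s) / (F.L : ℝ) ^ (2 * (K - n))) ≤ ε₀ * 1 :=
          mul_le_mul_of_nonneg_left ((div_le_one hpos).2 hle) hε₀.le
      _ = ε₀ := mul_one _
  rw [hd]
  push_cast
  rw [hLL]
  have h1 : (F.L : ℝ) ^ 2 * (10800 * (F.L : ℝ) + 1) * X ≤ (F.L : ℝ) ^ 2 * (10800 * (F.L : ℝ) + 1) * ε₀ :=
    mul_le_mul_of_nonneg_left hXε (by positivity)
  have h2 : (F.L : ℝ) ^ 2 * ε₀ ≤ (F.L : ℝ) ^ 3 * ε₀ :=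
    mul_le_mul_of_nonneg_right (pow_le_pow_right₀ (by linarith) (by norm_num)) hε₀.le
  nlinarith [h1, h2, hX0, mul_nonneg (sq_nonneg (F.L : ℝ)) hX0]

/-- **THE BACKGROUND TOWER'S LOOP VARIABLES ARE WITHIN `1∕16` OF `1` ON `𝔘_k(ε₀)`** (the `1∕16` form of ✓`loopHolU_emlIterU_bgUnits_le_eighth_of_regPr`).
[cite: Balaban1985Averaging, (19)-(20) p.21; Balaban1985Variational, (146) p.301; Balaban1987RG1, (0.4) p.253] -/
theorem loopHolU_emlIterU_bgUnits_le_sixteenth_of_regPr {ε₀ : ℝ} (hε₀ : 0 < ε₀) (hε : 10 ^ 7 * (F.L : ℝ) ^ 3 * ε₀ ≤ 1)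
    {U₀ : GaugeField (F.P K) 0 (Matrix.specialUnitaryGroup (Fin 2) ℂ)} (hreg : RegPr F n K ε₀ U₀) :
    ∀ j, j < K - n → ∀ (e : PBond (F.P K) (j + 1)) (i : Idx (F.P K)),
      ‖((loopHolU (emlIterU j (bgUnits F K U₀)) e i : (Matrix (Fin 2) (Fin 2) ℂ)ˣ) : Matrix (Fin 2) (Fin 2) ℂ) - 1‖ ≤ 1 / 16 := by
  intro j hj e i
  have hjle : j ≤ K - n := hj.le
  rw [bgUnits_eq, ← coe_iter_eq_emlIterU_of_regPr F n K hε₀ hε hreg hjle, coe_loopHolU_unitsField, ← dist1_SU_eq]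
  have ht0 : 0 ≤ (10800 * (F.L : ℝ) + 1) * ((F.L : ℝ) ^ (2 * j) * regThreshold F n K ε₀) := by unfold regThreshold; positivity
  exact (dist1_loopHol_le ht0 (plaqSmall_iter_T3_allL F n K hε₀ hε U₀ hreg.plaqSmall j hjle) e i).trans (loop_budget_sixteenth F n K hε₀ hε hjle)

set_option maxHeartbeats 400000 in
/-- ★★ **THE PERTURBED COVARIANT TOWER IS RELATIVELY CLOSE TO THE BACKGROUND TOWER, LEVEL BY LEVEL**: for `U₀ ∈ 𝔘_k(ε₀)`, `‖A(b)‖ ≤ e·η`, `10⁹L²e ≤ 1`, `10¹²L³ε₀ ≤ 1` and every `j ≤ K − n`: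
`‖U̿^{(j)}[e^{A}U₀♭](e′)·Ū^{(j)}[U₀♭](e′)⁻¹ − 1‖ ≤ 3(2e + 2700Lε₀)` — W3 part 1 ✓`norm_dbarCovIterU_rel_frameAccU_le_of_plaqSmall` at `k := j` with W1's one-step rows ✓`hstep_T3`∕✓`hframe_T3`,
its budgets at level `j` bounded by W2's at level `K − n` (✓`budget_T3_frames`, ✓`windows_of_numerals`; monotonicity in `j`). [cite: Balaban1985Averaging, (161)-(163) p.42, p.44;
Balaban1985Variational, (2) p.278] -/
theorem norm_dbarCovIterU_rel_sub_one_le_of_regPr {ε₀ e : ℝ} (hε₀ : 0 < ε₀) (he : 0 ≤ e) (hWe : 10 ^ 9 * (F.L : ℝ) ^ 2 * e ≤ 1) (hWε : 10 ^ 12 * (F.L : ℝ) ^ 3 * ε₀ ≤ 1)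
    (U₀ : GaugeField (F.P K) 0 (Matrix.specialUnitaryGroup (Fin 2) ℂ)) (hreg : RegPr F n K ε₀ U₀)
    (A : PBond (F.P K) 0 → Matrix (Fin 2) (Fin 2) ℂ) (hA : ∀ b, ‖A b‖ ≤ e * eta F n K) {j : ℕ} (hj : j ≤ K - n) (e' : PBond (F.P K) j) :
    ‖((dbarCovIterU j (bgUnits F K U₀) (fun b => expUnit (A b) * bgUnits F K U₀ b) e' : (Matrix (Fin 2) (Fin 2) ℂ)ˣ) : Matrix (Fin 2) (Fin 2) ℂ) *
          (((emlIterU j (bgUnits F K U₀) e')⁻¹ : (Matrix (Fin 2) (Fin 2) ℂ)ˣ) : Matrix (Fin 2) (Fin 2) ℂ) - 1‖ ≤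
      3 * (2 * e + 2700 * (F.L : ℝ) * ε₀) := by
  obtain ⟨hWF, hε, he6⟩ := windows_of_numerals F hε₀.le he hWe hWε
  have hd : (F.P K).d = 3 := T3Family.P_d F K
  have hLL : ((F.P K).L : ℝ) = F.L := rfl
  have hL3 : 3 ≤ F.L := by obtain ⟨a, ha⟩ := F.hL.1; have := F.hL.2; omega
  have hL0 : (0 : ℝ) < F.L := by exact_mod_cast (show 0 < F.L by omega)
  have hL1 : (1 : ℝ) ≤ ((F.P K).L : ℝ) := by rw [hLL]; exact_mod_cast (show 1 ≤ F.L by omega)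
  have hk1 : j + 1 ≤ (F.P K).m + (F.P K).K := by
    show j + 1 ≤ F.m + K; have := F.hm; omega
  have hℓ : ((((F.P K).d + 2) * (F.P K).L : ℕ) : ℝ) = 5 * (F.L : ℝ) := by
    rw [hd, ← hLL]; push_cast; ring
  obtain ⟨hsB0, hxX, hbud₀⟩ := budget_T3_frames F (n := n) (K := K) e hε₀ hε
  set η : ℝ := ((F.L : ℝ)⁻¹) ^ (K - n) with hη
  have hη0 : 0 < η := by positivity
  have hηne : η ≠ 0 := hη0.ne'
  have hηeta : eta F n K = η := rfl
  set a₀ : ℝ := regThreshold F n K ε₀ with ha₀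
  have ha₀0 : 0 < a₀ := by rw [ha₀]; unfold regThreshold; positivity
  have hXa : (F.L : ℝ) ^ (K - n) * ((F.L : ℝ) ^ (K - n) * a₀) = ε₀ := by
    have hX2 : (F.L : ℝ) ^ (K - n) * (F.L : ℝ) ^ (K - n) = (F.L : ℝ) ^ (2 * (K - n)) := by rw [← pow_add, two_mul]
    have ha : a₀ = ε₀ * ((F.L : ℝ) ^ (2 * (K - n)))⁻¹ := by rw [ha₀]; unfold regThreshold; rw [inv_pow]
    rw [← mul_assoc, hX2, ha, mul_comm ε₀, ← mul_assoc, mul_inv_cancel₀ (pow_ne_zero _ hL0.ne'), one_mul]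
  have hU := hreg.1
  obtain ⟨ht1, -, -, -⟩ := budget_T3 F (K - n) hε₀ hε he he6 ha₀0.le hXa
  -- the level-`j` budgets from the level-`(K − n)` ones (monotonicity in `j`)
  set ℓr : ℝ := ((((F.P K).d + 2) * (F.P K).L : ℕ) : ℝ) with hℓr
  have hℓ0 : 0 ≤ ℓr := Nat.cast_nonneg _
  have hpow : ((F.P K).L : ℝ) ^ j ≤ ((F.P K).L : ℝ) ^ (K - n) := pow_le_pow_right₀ hL1 hj
  have hpow0 : 0 ≤ ((F.P K).L : ℝ) ^ j := by positivity
  have hd0 : 0 ≤ ((F.P K).d : ℝ) := Nat.cast_nonneg _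
  set sBj : ℝ := 2 * (((F.P K).d : ℝ) * (3 * ((F.P K).L : ℝ) ^ j - 1)) * a₀ with hsBj
  set sBk : ℝ := 2 * (((F.P K).d : ℝ) * (3 * ((F.P K).L : ℝ) ^ (K - n) - 1)) * a₀ with hsBk
  have h3j : 0 ≤ 3 * ((F.P K).L : ℝ) ^ j - 1 := by linarith [one_le_pow₀ (n := j) hL1]
  have hsBj0 : 0 ≤ sBj := by rw [hsBj]; positivity
  have hsB : sBj ≤ sBk := by
    rw [hsBj, hsBk]
    have : ((F.P K).d : ℝ) * (3 * ((F.P K).L : ℝ) ^ j - 1) ≤ ((F.P K).d : ℝ) * (3 * ((F.P K).L : ℝ) ^ (K - n) - 1) :=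
      mul_le_mul_of_nonneg_left (by linarith) hd0
    nlinarith [ha₀0.le]
  have hte0 : 0 ≤ η * e := by positivity
  have hxj : ((F.P K).L : ℝ) ^ j * (2 * (η * e) + 30 * ℓr * sBj) ≤ ((F.P K).L : ℝ) ^ (K - n) * (2 * (η * e) + 30 * ℓr * sBk) := by
    apply mul_le_mul hpow _ (by positivity) (by positivity)
    nlinarith [mul_le_mul_of_nonneg_left hsB (by positivity : (0 : ℝ) ≤ 30 * ℓr)]
  have hbud₀j : 6400 * ℓr ^ 2 * ((F.P K).L : ℝ) ^ j * sBj ≤ 1 := by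
    refine le_trans ?_ hbud₀
    have h1 : 6400 * ℓr ^ 2 * ((F.P K).L : ℝ) ^ j * sBj ≤ 6400 * ℓr ^ 2 * ((F.P K).L : ℝ) ^ (K - n) * sBj :=
      mul_le_mul_of_nonneg_right (mul_le_mul_of_nonneg_left hpow (by positivity)) hsBj0
    have h2 : 6400 * ℓr ^ 2 * ((F.P K).L : ℝ) ^ (K - n) * sBj ≤ 6400 * ℓr ^ 2 * ((F.P K).L : ℝ) ^ (K - n) * sBk :=
      mul_le_mul_of_nonneg_left hsB (by positivity)
    exact h1.trans h2
  have hbudj : 8 * (16 * (22100 : ℝ) + 2) * ℓr ^ 2 * (((F.P K).L : ℝ) ^ j * (2 * (η * e) + 30 * ℓr * sBj)) ≤ 1 := by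
    have hC : 0 ≤ 8 * (16 * (22100 : ℝ) + 2) * ℓr ^ 2 := by positivity
    refine (mul_le_mul_of_nonneg_left (hxj.trans hxX) hC).trans ?_
    rw [hℓ]; exact hWF
  -- the reads of the rescaled exponent `A″ = (iη)⁻¹A`: `‖ηA″(b)‖ ≤ ηe`
  have hA' : ∀ b, ‖(η : ℂ) • ((fun b => (Complex.I * (η : ℂ))⁻¹ • A b) b)‖ ≤ η * e := fun b =>
    norm_smul_eta_inv_le F hηne A (fun b => by rw [← hηeta]; exact hA b) b
  obtain ⟨hrel, -, -⟩ := norm_dbarCovIterU_rel_frameAccU_le_of_plaqSmall (P := F.P K) (by norm_num : (2 : ℝ) ≤ 22100) (hstep_T3 F) (hframe_T3 F) hk1 U₀ ha₀0 hU η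
    (fun b => (Complex.I * (η : ℂ))⁻¹ • A b) ht1 hA' hbud₀j hbudj e'
  have hW : (fun b => expUnit (A b) * bgUnits F K U₀ b) = fun b => expCfg η (fun b => (Complex.I * (η : ℂ))⁻¹ • A b) b * unitsField (toUField U₀) b :=
    perturbedField_eq F K hηne U₀ A
  rw [hW, bgUnits_eq]
  exact hrel.trans (by linarith)

/-! ## §3 The row `htower`, and (Q-b)⁽²⁾ unconditionally at `U₀ ∈ 𝔘_k(ε₀)` -/

/-- ★★★ **THE DISPLAYED ROW `htower` SUPPLIED**: at `U₀ ∈ 𝔘_k(ε₀)` (`10¹²L³ε₀ ≤ 1`), on the ball `‖A‖ < η∕(10⁹L²)`, at every level `j < K − n` the loop variables of the perturbed covariant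
tower and its twisted stair transporters against the background tower are within `1∕8` of `1` (`δ := 6(2e + 2700Lε₀)`, `2ℓδ ≤ 1∕16`; background loops `≤ 1∕16`).
[cite: Balaban1985Averaging, (89)-(92) p.31, (161)-(163) p.42, p.44; Balaban1987RG1, (0.3)-(0.4) pp.252-253] -/
theorem towerRows_of_regPr {ε₀ : ℝ} (hε₀ : 0 < ε₀) (hWε : 10 ^ 12 * (F.L : ℝ) ^ 3 * ε₀ ≤ 1)
    (U₀ : GaugeField (F.P K) 0 (Matrix.specialUnitaryGroup (Fin 2) ℂ)) (hreg : RegPr F n K ε₀ U₀) :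
    ∃ ρ : ℝ, 0 < ρ ∧ ∀ A : PBond (F.P K) 0 → Matrix (Fin 2) (Fin 2) ℂ, ‖A‖ < ρ →
      (∀ j, j < K - n → ∀ (c : PBond (F.P K) (j + 1)) (i : Idx (F.P K)),
        ‖((loopHolU (dbarCovIterU j (bgUnits F K U₀) (fun b => expUnit (A b) * bgUnits F K U₀ b)) c i : (Matrix (Fin 2) (Fin 2) ℂ)ˣ) : Matrix (Fin 2) (Fin 2) ℂ) - 1‖ ≤ 1 / 8) ∧
      (∀ j, j < K - n → ∀ (y : Site (F.P K) (j + 1)) (i : Idx (F.P K)),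
        ‖((tstairU (emlIterU j (bgUnits F K U₀)) (dbarCovIterU j (bgUnits F K U₀) (fun b => expUnit (A b) * bgUnits F K U₀ b)) y i : (Matrix (Fin 2) (Fin 2) ℂ)ˣ) :
          Matrix (Fin 2) (Fin 2) ℂ) - 1‖ ≤ 1 / 8) := by
  have hd : (F.P K).d = 3 := T3Family.P_d F K
  have hLL : ((F.P K).L : ℝ) = F.L := rfl
  have hL3 : 3 ≤ F.L := by obtain ⟨a, ha⟩ := F.hL.1; have := F.hL.2; omega
  have hL1 : (1 : ℝ) ≤ F.L := by exact_mod_cast (show 1 ≤ F.L by omega)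
  have hε7 : 10 ^ 7 * (F.L : ℝ) ^ 3 * ε₀ ≤ 1 := by
    have h1 : (0 : ℝ) ≤ (F.L : ℝ) ^ 3 * ε₀ := by positivity
    nlinarith
  set e : ℝ := (10 ^ 9 * (F.L : ℝ) ^ 2)⁻¹ with he
  have hpos : (0 : ℝ) < 10 ^ 9 * (F.L : ℝ) ^ 2 := by positivity
  have he0 : 0 < e := by rw [he]; exact inv_pos.2 hpos
  have hWe : 10 ^ 9 * (F.L : ℝ) ^ 2 * e ≤ 1 := by rw [he, mul_inv_cancel₀ hpos.ne']
  have hℓ : ((((F.P K).d + 2) * (F.P K).L : ℕ) : ℝ) = 5 * (F.L : ℝ) := by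
    rw [hd, ← hLL]; push_cast; ring
  -- the numerics: `r := 3(2e + 2700Lε₀) ≤ ½`, `δ := 2r`, `2ℓδ ≤ 1/16`
  set r : ℝ := 3 * (2 * e + 2700 * (F.L : ℝ) * ε₀) with hr
  have hr0 : 0 ≤ r := by positivity
  have he9 : 10 ^ 9 * ((F.L : ℝ) * e) ≤ 1 := by
    have hL12 : (F.L : ℝ) ≤ (F.L : ℝ) ^ 2 := by nlinarith
    have : (F.L : ℝ) * e ≤ (F.L : ℝ) ^ 2 * e := mul_le_mul_of_nonneg_right hL12 he0.le
    nlinarith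
  have hLε : 10 ^ 12 * ((F.L : ℝ) ^ 2 * ε₀) ≤ 1 := by
    have : (F.L : ℝ) ^ 2 * ε₀ ≤ (F.L : ℝ) ^ 3 * ε₀ := mul_le_mul_of_nonneg_right (pow_le_pow_right₀ hL1 (by norm_num : 2 ≤ 3)) hε₀.le
    linarith
  have hnum : 2 * ((((F.P K).d + 2) * (F.P K).L : ℕ) : ℝ) * (2 * r) ≤ 1 / 16 := by
    rw [hℓ, hr]
    have e1 : 2 * (5 * (F.L : ℝ)) * (2 * (3 * (2 * e + 2700 * (F.L : ℝ) * ε₀))) = 120 * ((F.L : ℝ) * e) + 162000 * ((F.L : ℝ) ^ 2 * ε₀) := by ring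
    rw [e1]; nlinarith
  have hr2 : r ≤ 1 / 2 := by
    have hℓ1 : (1 : ℝ) ≤ 2 * ((((F.P K).d + 2) * (F.P K).L : ℕ) : ℝ) := by rw [hℓ]; linarith
    nlinarith
  refine ⟨e * eta F n K, mul_pos he0 (eta_pos F n K), fun A hA => ?_⟩
  have hAb : ∀ b, ‖A b‖ ≤ e * eta F n K := norm_apply_le_of_mem_ball F hA
  -- per level: the background tower is `U1`-valued, the perturbed tower `r`-close to it relatively
  have hV : ∀ j, j < K - n → ∀ b : PBond (F.P K) j, emlIterU j (bgUnits F K U₀) b ∈ U1 (Matrix (Fin 2) (Fin 2) ℂ) :=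
    fun j hj b => emlIterU_bgUnits_mem_U1_of_regPr F hε₀ hε7 hreg hj.le b
  have hrel : ∀ j, j < K - n → ∀ b : PBond (F.P K) j,
      ‖((dbarCovIterU j (bgUnits F K U₀) (fun b => expUnit (A b) * bgUnits F K U₀ b) b : (Matrix (Fin 2) (Fin 2) ℂ)ˣ) : Matrix (Fin 2) (Fin 2) ℂ) *
          (((emlIterU j (bgUnits F K U₀) b)⁻¹ : (Matrix (Fin 2) (Fin 2) ℂ)ˣ) : Matrix (Fin 2) (Fin 2) ℂ) - 1‖ ≤ r :=
    fun j hj b => norm_dbarCovIterU_rel_sub_one_le_of_regPr F hε₀ he0.le hWe hWε U₀ hreg A hAb hj.le b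
  have h₁ : ∀ j, j < K - n → ∀ b : PBond (F.P K) j,
      ‖((dbarCovIterU j (bgUnits F K U₀) (fun b => expUnit (A b) * bgUnits F K U₀ b) b : (Matrix (Fin 2) (Fin 2) ℂ)ˣ) : Matrix (Fin 2) (Fin 2) ℂ) -
          ((emlIterU j (bgUnits F K U₀) b : (Matrix (Fin 2) (Fin 2) ℂ)ˣ) : Matrix (Fin 2) (Fin 2) ℂ)‖ ≤ 2 * r :=
    fun j hj b => (norm_sub_le_of_rel (hV j hj b) (hrel j hj b)).trans (by linarith)
  have h₂ : ∀ j, j < K - n → ∀ b : PBond (F.P K) j,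
      ‖(((dbarCovIterU j (bgUnits F K U₀) (fun b => expUnit (A b) * bgUnits F K U₀ b) b)⁻¹ : (Matrix (Fin 2) (Fin 2) ℂ)ˣ) : Matrix (Fin 2) (Fin 2) ℂ) -
          (((emlIterU j (bgUnits F K U₀) b)⁻¹ : (Matrix (Fin 2) (Fin 2) ℂ)ˣ) : Matrix (Fin 2) (Fin 2) ℂ)‖ ≤ 2 * r :=
    fun j hj b => norm_inv_sub_inv_le_of_rel (hV j hj b) hr2 (hrel j hj b)
  have hδ0 : 0 ≤ 2 * r := by positivity
  have hℓδ : 2 * ((((F.P K).d + 2) * (F.P K).L : ℕ) : ℝ) * (2 * r) ≤ 1 := hnum.trans (by norm_num)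
  refine ⟨fun j hj c i => ?_, fun j hj y i => ?_⟩
  · have h1 := norm_loopHolU_sub_one_le_of_rel _ _ hδ0 (hV j hj) (h₁ j hj) (h₂ j hj) hℓδ c i
    have h2 := loopHolU_emlIterU_bgUnits_le_sixteenth_of_regPr F hε₀ hε7 hreg j hj c i
    linarith
  · exact (norm_tstairU_sub_one_le_of_rel _ _ hδ0 (hV j hj) (h₁ j hj) (h₂ j hj) hℓδ y i).trans (hnum.trans (by norm_num))

/-- ★★★ **(Q-b)⁽²⁾ UNCONDITIONALLY AT `U₀ ∈ 𝔘_k(ε₀)`: p01 g2's `hAvgC` VERBATIM, NO DISPLAYED ROW** — `∀ X z, fderiv ℂ (fun A => fderiv ℂ (logChartTwS F n K h U₀) A) 0 X (z·1) = 0`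
(`= avgHess F n K h U₀ X (fun b => z b • 1) = 0`; `10¹²L³ε₀ ≤ 1`). [cite: Balaban1985BackgroundPropagators, (3.14) p.393, (3.127) p.421; Balaban1985Averaging, (125)-(127) p.36] -/
theorem fderiv_fderiv_logChartTwS_central_eq_zero_at_regPr {ε₀ : ℝ} (hε₀ : 0 < ε₀) (hWε : 10 ^ 12 * (F.L : ℝ) ^ 3 * ε₀ ≤ 1)
    (U₀ : GaugeField (F.P K) 0 (Matrix.specialUnitaryGroup (Fin 2) ℂ)) (hreg : RegPr F n K ε₀ U₀) :
    ∀ (X : PBond (F.P K) 0 → Matrix (Fin 2) (Fin 2) ℂ) (z : PBond (F.P K) 0 → ℂ),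
      fderiv ℂ (fun A => fderiv ℂ (logChartTwS F n K h U₀) A) 0 X (fun b => z b • (1 : Matrix (Fin 2) (Fin 2) ℂ)) = 0 :=
  fderiv_fderiv_logChartTwS_central_eq_zero_of_regPr F h hε₀ hWε U₀ hreg (towerRows_of_regPr F hε₀ hWε U₀ hreg)

/-- **both slots**: `D²(log U̿^{twS})(0)[X, z·1] = 0 = D²(log U̿^{twS})(0)[z·1, X]` at `U₀ ∈ 𝔘_k(ε₀)`, no displayed row. [cite: Balaban1985BackgroundPropagators, (3.14) p.393] -/
theorem fderiv_fderiv_logChartTwS_smul_one_eq_zero_at_regPr {ε₀ : ℝ} (hε₀ : 0 < ε₀) (hWε : 10 ^ 12 * (F.L : ℝ) ^ 3 * ε₀ ≤ 1)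
    (U₀ : GaugeField (F.P K) 0 (Matrix.specialUnitaryGroup (Fin 2) ℂ)) (hreg : RegPr F n K ε₀ U₀)
    (z : PBond (F.P K) 0 → ℂ) (X : PBond (F.P K) 0 → Matrix (Fin 2) (Fin 2) ℂ) :
    fderiv ℂ (fun A => fderiv ℂ (logChartTwS F n K h U₀) A) 0 X (fun b => z b • (1 : Matrix (Fin 2) (Fin 2) ℂ)) = 0 ∧
      fderiv ℂ (fun A => fderiv ℂ (logChartTwS F n K h U₀) A) 0 (fun b => z b • (1 : Matrix (Fin 2) (Fin 2) ℂ)) X = 0 :=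
  fderiv_fderiv_logChartTwS_smul_one_eq_zero_of_regPr F h hε₀ hWε U₀ hreg (towerRows_of_regPr F hε₀ hWε U₀ hreg) z X

end T3

end Summit.QuantumFields.YangMills.Theorems.Prop7SymAvgTwSym

end
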